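import Summits.QuantumFields.YangMills.Theorems.UnitScaleTiltProp7PcolMember
import Summits.QuantumFields.YangMills.Theorems.UnitScaleTiltProp7MassiveSolutionOfCover
import Summits.QuantumFields.YangMills.Theorems.UnitScaleTiltProp7KernelRow349OfCover
import Summits.QuantumFields.YangMills.Theorems.UnitScaleTiltHalvingSmallMembersCoverLift
import HarnessLib

/-!
# Route `UnitScaleTilt`, crux K1 «MinimiserStabilityRegPr» (stmt-QuantumFields-19200), EX face S46 → S47, row `hPcol` — **THE hPcol ALL-MEMBERS ∃-PACKAGE (namer w2 g12's S47 SOCKET SHAPE)**: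
# there are `αP pP : ℕ → ℝ` with `0 < αP L`, `0 ≤ pP L` such that for EVERY `L > 1`, every member `i : Idx L`, every `0 ≤ a′`, every `U₀ ∈ RegPr (αP L)` satisfying the face's
# Lift antecedent, `Σ_x ‖toL2S⁻¹(G′ᴾ_{a′}(R_S(D*_{U₀}(toL2(δ_bd ⊗ E)))))(x)‖ ≤ pP L·‖E‖`.  Roomy members: PIN-B ✓`Prop7PcolMember.hPcol_member_of_lift`.  Members without the no-wrap room of
# T1: the SAME letters at the member, with `hGsup`∕`hT1` DESCENDED from the member's `L³`-fold cover `F.cover 3` (px12 g16's ✓`Prop7MassiveSolutionOfCover.hGsup_of_cover`∕`hT1_of_cover`: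
# `G_a` is natural under the cover; the cover member HAS room, ✓`room_cover`), the cover member's constants rewritten by three cover-shaped leaf identities into the SAME member-free numbers.

Cell `ym3-torus` (HUMAN RULING D-0037; rung R3 = SU(2) YM₃ on T³ — NOT d = 4, NOT infinite volume, NOT a mass gap, NOT Clay).  Width seat `ym3-torus-px5` (gen 13); CHAIR WORD №9 (ii)
«hPcol BOOK = PIN-A → PIN-B → AllMembers → S47».  THEOREMS ONLY (0 `def`, 0 `sorry`); `--supports stmt-QuantumFields-19200 --as helper`; count-neutral.

WHAT IS PROVED (ns `Summit.QuantumFields.YangMills.Theorems.Prop7PcolAllMembers`).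
* §1 `unitP1_cover`∕`unitP3_cover`∕`unitP2_cover` — PIN-B's three leaf identities for ✓p765745 §6's units READ ON THE COVER MEMBER `F.cover jc` at the member's pinned weight `c₁ := c₀·(L³)^{K−n}`
  (`(F.cover jc).L = F.L` is `rfl`): the cover member's `B_v`∕`R₁` are the member's numbers.
* §2 ★★★ `hPcol_member_all` — PIN-B §3 ✓`hPcol_member_of_lift` WITHOUT the room binder: `by_cases` on the room; no room ⇒ the member's `Q″ ι T G` of record and `hcol` (V5b) at the member,
  the cover member's `Q_c ι_c T_c G_c` of record (✓`exists_intertwiner_of_regPr`, `rfl`, adjoint, ✓`exists_massive_inverse`), its window rows at `μ(am)` (✓`window_delta`∕`window_win`),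
  ✓`hGsup_of_regPr`∕`hT1_of_regPr` there (room by ✓`room_cover`, `RegPr` by ✓`regPr_cover_iff`), §1's rewrite, ✓`hGsup_of_cover`∕`hT1_of_cover`, then PIN-A ✓`hPcol_pin` and the `C_pt` leaves —
  SAME member-free constant `p139⋆(am, ε₀)` as PIN-B, for EVERY member.
* §3 ★★★ `hPcol_allMembers_exists` — THE SOCKET (the margin `C∕(2(C+1)) ≤ ½` inlined; ✓p765417's `margin_ratio_le_half` is the landed statement): `αP L := min (10⁻¹²L⁻³) (1∕(2·(C_g + 1)·48(6√2√10 + 6√2)))`, `pP L := p139⋆(1, αP L)` (px10 g12's ✓p765417 packaging).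
HYP-SAT (★★OWNER RULING №42): the conclusion's antecedents are the face's own (`RegPr`, Lift); `αP L > 0` explicit; `hsmall` DERIVED from `αP`; nothing eventual; non-vacuous.
HONEST SCOPE.  Packaging + three leaf identities; nothing of P4∕PIN-A∕PIN-B∕V4∕V5b∕T1∕the cover road themselves, S47, the nine other print rows, `hThm2S`, EX or the crux is proved here;
the Yang–Mills mass gap is NOT proved.

References: T. Bałaban, CMP **99** (1985) 389–434 [Balaban1985BackgroundPropagators] (Thm 3.1–3.3 (3.42)–(3.49) pp.397–399, (3.114)–(3.122) pp.418–420); CMP **102** (1985) 277–309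
[Balaban1985Variational] ((138)–(139) p.299, (144) p.300); CMP **109** (1987) 249–301 [Balaban1987RG1] ((0.1)–(0.2) pp.251–252).
-/

set_option autoImplicit false

noncomputable section

open scoped BigOperators Matrix.Norms.L2Operator InnerProductSpace ComplexConjugate Matrix

namespace Summit.QuantumFields.YangMills.Theorems.Prop7PcolAllMembers

open Literature.MathematicalPhysics.QuantumFieldTheory.Balaban1983to89
open Literature.MathematicalPhysics.QuantumFieldTheory.Balaban1983to89.T3ContinuumYM3Torus
open T4Continuum BlockAveraging
open BlockAveraging (Idx)
open B7Prop1Explicit (disp)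
open B5Eq118OneStroke (iterBlockOf)
open B15DeterminingSets (embIter)
open B10Eq27TorusAxialLog (holT transl)
open B7TransferAnalyticMean (meanCLM)
open B4Sect5Torus (TSite)
open B9SectCLatticeCarrier (Bond)
open B9Eq311L2Pairing (WL2)
open B11Eq103H1Complex (SiteL2K BondL2K projR)
open Summit.QuantumFields.YangMills.Theorems.Prop8Chart (emlIterU)
open T3SectALandauChart (eta eta_pos bgUnits)
open T3PrintedRegularMinimiser (RegPr)
open T3PrintedRegularOrbits (sites_eq)
open T3LevelShift (siteShift)
open Summit.QuantumFields.YangMills.Theorems.Prop7SectET3Transport (periodsT3 siteEquiv bondEquiv)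
open Summit.QuantumFields.YangMills.Theorems.Prop7SectET3HilbertLetters (W₂ toL2 toL2S DL2 DstarL2 covLapSite)
open Summit.QuantumFields.YangMills.Theorems.Prop7SectET3GaugeProjector (NS RS)
open Summit.QuantumFields.YangMills.Theorems.Prop7SectET3DeltaPiPInv (kerDProj GprimeP)
open Summit.QuantumFields.YangMills.Theorems.Prop7CurvedMemberLocalGradient (exists_curved_localGradient)
open Summit.QuantumFields.YangMills.Theorems.AxialGaugeChartGlue (norm_bgOfCfg_axialT_sub_le)
open Summit.QuantumFields.YangMills.Theorems.Prop7LODSlotK2WindowLetters (window_delta window_win)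
open Summit.QuantumFields.YangMills.Theorems.Prop7ComplementaryProjectorPointwiseDecayClosed (hcol_of_massiveColumn_decay)
open Summit.QuantumFields.YangMills.Theorems.Prop7MassiveSolutionGradientSupOfRegPr (hGsup_of_regPr hT1_of_regPr)
open Summit.QuantumFields.YangMills.Theorems.Prop7CurvedMemberGradientRowPin (unitA_pin unitU1_pin unitU3_pin)
open Summit.QuantumFields.YangMills.Theorems.Prop7NSIntertwinerOfRecord (exists_intertwiner_of_regPr)
open Summit.QuantumFields.YangMills.Theorems.Prop7RSEqPrintProjectorOfLift (RS_eq_projR_of_lift)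
open Summit.QuantumFields.YangMills.Theorems.Prop7MassivePropagatorCoercive (exists_massive_inverse)
open Summit.QuantumFields.YangMills.Theorems.Prop7PcolPin (hPcol_pin)
open Summit.QuantumFields.YangMills.Theorems.Prop7PcolMember (hPcol_member_of_lift)
open Summit.QuantumFields.YangMills.Theorems.CoverSites (proj projBond T3Family.cover_L T3Family.cover_m)
open Summit.QuantumFields.YangMills.Theorems.SmallMembersCoverLift (regPr_cover_iff)
open Summit.QuantumFields.YangMills.Theorems.Prop7KernelRow349OfCover (room_cover)
open Summit.QuantumFields.YangMills.Theorems.Prop7MassiveSolutionOfCover (hGsup_of_cover hT1_of_cover)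

/-! ## §1 PIN-B's three leaves read on the cover member (same numbers) -/

section Pin

variable (F : T3Family) (jc : ℕ) {n K : ℕ} {c₀ : ℝ}

/-- **(P1, cover)** ✓`Prop7PcolMember.unitP1_pin` on `F.cover jc` at the member's pinned weight. [cite: Balaban1985BackgroundPropagators, (3.24) p.394, Thm 3.1 (3.42) p.397] -/
theorem unitP1_cover (hc₀ : 0 < c₀) {am : ℝ} (ham : 0 < am) :
    (am * ((5 / 4) * Real.sqrt (2 * (c₀ * ((F.L : ℝ) ^ 3) ^ (K - n))) * (((((F.cover jc).P K).L : ℝ) ^ ((F.cover jc).P K).d) ^ (K - n))⁻¹ / c₀) * Real.sqrt ((25 / 8) * ((c₀ * ((F.L : ℝ) ^ 3) ^ (K - n)) * (((((F.cover jc).P K).L : ℝ) ^ ((F.cover jc).P K).d) ^ (K - n))⁻¹ / c₀))) * ((8 * Real.sqrt (max 2 (16 * c₀ * (((F.cover jc).L : ℝ) ^ (K - n)) ^ 3 / (am * (c₀ * ((F.L : ℝ) ^ 3) ^ (K - n))))) ^ 2) * (Real.sqrt (c₀ * (((((F.cover jc).P K).L : ℝ) ^ ((F.cover jc).P K).d)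 ^ (K - n))) * 1)) = am * ((5 / 4) * Real.sqrt 2) * Real.sqrt (25 / 8) * (8 * Real.sqrt (max 2 (16 / am)) ^ 2) := by
  have hL : (0 : ℝ) < F.L := by have := F.hL.2; exact_mod_cast (by omega : 0 < F.L)
  have hLc : ((F.cover jc).L : ℝ) = (F.L : ℝ) := rfl
  have hPL : (((F.cover jc).P K).L : ℝ) = (F.L : ℝ) := rfl
  have hX : ((((F.cover jc).P K).L : ℝ) ^ ((F.cover jc).P K).d) ^ (K - n) = ((F.L : ℝ) ^ 3) ^ (K - n) := by rw [hPL, T3Family.P_d]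
  have h3 : ((F.L : ℝ) ^ 3) ^ (K - n) ≠ 0 := by positivity
  have hC1 : 0 < c₀ * ((F.L : ℝ) ^ 3) ^ (K - n) := by positivity
  have hS : (25 / 8 : ℝ) * ((c₀ * ((F.L : ℝ) ^ 3) ^ (K - n)) * (((((F.cover jc).P K).L : ℝ) ^ ((F.cover jc).P K).d) ^ (K - n))⁻¹ / c₀) = 25 / 8 := by
    rw [hX]; field_simp
  have hM : 16 * c₀ * (((F.cover jc).L : ℝ) ^ (K - n)) ^ 3 / (am * (c₀ * ((F.L : ℝ) ^ 3) ^ (K - n))) = 16 / am := by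
    rw [hLc, ← pow_mul, ← pow_mul, mul_comm (K - n) 3]
    have h3' : (F.L : ℝ) ^ (3 * (K - n)) ≠ 0 := by positivity
    field_simp
  have hs2 : Real.sqrt (2 * (c₀ * ((F.L : ℝ) ^ 3) ^ (K - n))) = Real.sqrt 2 * Real.sqrt (c₀ * ((F.L : ℝ) ^ 3) ^ (K - n)) := Real.sqrt_mul (by norm_num) _
  have hr : Real.sqrt (c₀ * ((F.L : ℝ) ^ 3) ^ (K - n)) * Real.sqrt (c₀ * ((F.L : ℝ) ^ 3) ^ (K - n)) = c₀ * ((F.L : ℝ) ^ 3) ^ (K - n) := Real.mul_self_sqrt hC1.le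
  rw [hS, hM, hX, hs2]
  refine Eq.trans (b := am * ((5 / 4) * Real.sqrt 2) * Real.sqrt (25 / 8) * (8 * Real.sqrt (max 2 (16 / am)) ^ 2)
      * ((Real.sqrt (c₀ * ((F.L : ℝ) ^ 3) ^ (K - n)) * Real.sqrt (c₀ * ((F.L : ℝ) ^ 3) ^ (K - n))) * (((F.L : ℝ) ^ 3) ^ (K - n))⁻¹ / c₀)) (by ring) ?_
  rw [hr]; field_simp

/-- **(P3, cover)** ✓`Prop7PcolMember.unitP3_pin` on `F.cover jc`. [cite: Balaban1985BackgroundPropagators, (3.24) p.394] -/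
theorem unitP3_cover (hc₀ : 0 < c₀) {am : ℝ} (ham : 0 < am) (μ : ℝ) :
    am * ((5 / 4) * Real.sqrt (2 * (c₀ * ((F.L : ℝ) ^ 3) ^ (K - n))) * (((((F.cover jc).P K).L : ℝ) ^ ((F.cover jc).P K).d) ^ (K - n))⁻¹ / c₀) * Real.sqrt ((25 / 8) * ((c₀ * ((F.L : ℝ) ^ 3) ^ (K - n)) * (((((F.cover jc).P K).L : ℝ) ^ ((F.cover jc).P K).d) ^ (K - n))⁻¹ / c₀)) * (Real.exp (3 * μ) * (8 * Real.sqrt (max 2 (16 * c₀ * (((F.cover jc).L : ℝ) ^ (K - n)) ^ 3 / (am * (c₀ * ((F.L : ℝ) ^ 3) ^ (K - n))))) ^ 2) * (Real.sqrt (c₀ * (((((F.cover jc).P K).L : ℝ) ^ ((F.cover jc).P K).d) ^ (K - n))) * 1)) = am * ((5 / 4) * Real.sqrt 2) * Real.sqrt (25 / 8) * (Real.exp (3 * μ) * (8 * Real.sqrt (max 2 (16 / am)) ^ 2)) := by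
  have hL : (0 : ℝ) < F.L := by have := F.hL.2; exact_mod_cast (by omega : 0 < F.L)
  have hLc : ((F.cover jc).L : ℝ) = (F.L : ℝ) := rfl
  have hPL : (((F.cover jc).P K).L : ℝ) = (F.L : ℝ) := rfl
  have hX : ((((F.cover jc).P K).L : ℝ) ^ ((F.cover jc).P K).d) ^ (K - n) = ((F.L : ℝ) ^ 3) ^ (K - n) := by rw [hPL, T3Family.P_d]
  have h3 : ((F.L : ℝ) ^ 3) ^ (K - n) ≠ 0 := by positivity
  have hC1 : 0 < c₀ * ((F.L : ℝ) ^ 3) ^ (K - n) := by positivity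
  have hS : (25 / 8 : ℝ) * ((c₀ * ((F.L : ℝ) ^ 3) ^ (K - n)) * (((((F.cover jc).P K).L : ℝ) ^ ((F.cover jc).P K).d) ^ (K - n))⁻¹ / c₀) = 25 / 8 := by
    rw [hX]; field_simp
  have hM : 16 * c₀ * (((F.cover jc).L : ℝ) ^ (K - n)) ^ 3 / (am * (c₀ * ((F.L : ℝ) ^ 3) ^ (K - n))) = 16 / am := by
    rw [hLc, ← pow_mul, ← pow_mul, mul_comm (K - n) 3]
    have h3' : (F.L : ℝ) ^ (3 * (K - n)) ≠ 0 := by positivity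
    field_simp
  have hs2 : Real.sqrt (2 * (c₀ * ((F.L : ℝ) ^ 3) ^ (K - n))) = Real.sqrt 2 * Real.sqrt (c₀ * ((F.L : ℝ) ^ 3) ^ (K - n)) := Real.sqrt_mul (by norm_num) _
  have hr : Real.sqrt (c₀ * ((F.L : ℝ) ^ 3) ^ (K - n)) * Real.sqrt (c₀ * ((F.L : ℝ) ^ 3) ^ (K - n)) = c₀ * ((F.L : ℝ) ^ 3) ^ (K - n) := Real.mul_self_sqrt hC1.le
  rw [hS, hM, hX, hs2]
  refine Eq.trans (b := am * ((5 / 4) * Real.sqrt 2) * Real.sqrt (25 / 8) * (Real.exp (3 * μ) * (8 * Real.sqrt (max 2 (16 / am)) ^ 2))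
      * ((Real.sqrt (c₀ * ((F.L : ℝ) ^ 3) ^ (K - n)) * Real.sqrt (c₀ * ((F.L : ℝ) ^ 3) ^ (K - n))) * (((F.L : ℝ) ^ 3) ^ (K - n))⁻¹ / c₀)) (by ring) ?_
  rw [hr]; field_simp

/-- **(P2, cover)** ✓`Prop7PcolMember.unitP2_pin` on `F.cover jc`. [cite: Balaban1985BackgroundPropagators, Thm 3.1 (3.43) p.398] -/
theorem unitP2_cover (hc₀ : 0 < c₀) {am : ℝ} (ham : 0 < am) (μ : ℝ) :
    Real.sqrt (3 ^ 3 / (c₀ * (((F.cover jc).L : ℝ) ^ (K - n)) ^ 3) * 8) * (Real.sqrt (8 * Real.exp (3 * min μ (1 / 4)) * Real.exp (6 * μ) * (2 * (1 + 1 / μ)) ^ 3) * ((8 * Real.sqrt (max 2 (16 * c₀ * (((F.cover jc).L : ℝ) ^ (K - n)) ^ 3 / (am * (c₀ * ((F.L : ℝ) ^ 3) ^ (K - n))))) ^ 2) * (Real.sqrt (c₀ * (((((F.cover jc).P K).L : ℝ) ^ ((F.cover jc).P K).d) ^ (K - n))) * 1))) = Real.sqrt 216 * (Real.sqrt (8 *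 Real.exp (3 * min μ (1 / 4)) * Real.exp (6 * μ) * (2 * (1 + 1 / μ)) ^ 3) * (8 * Real.sqrt (max 2 (16 / am)) ^ 2)) := by
  have hL : (0 : ℝ) < F.L := by have := F.hL.2; exact_mod_cast (by omega : 0 < F.L)
  have hLc : ((F.cover jc).L : ℝ) = (F.L : ℝ) := rfl
  have hPL : (((F.cover jc).P K).L : ℝ) = (F.L : ℝ) := rfl
  have hX : ((((F.cover jc).P K).L : ℝ) ^ ((F.cover jc).P K).d) ^ (K - n) = ((F.L : ℝ) ^ 3) ^ (K - n) := by rw [hPL, T3Family.P_d]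
  have hM : 16 * c₀ * (((F.cover jc).L : ℝ) ^ (K - n)) ^ 3 / (am * (c₀ * ((F.L : ℝ) ^ 3) ^ (K - n))) = 16 / am := by
    rw [hLc, ← pow_mul, ← pow_mul, mul_comm (K - n) 3]
    have h3' : (F.L : ℝ) ^ (3 * (K - n)) ≠ 0 := by positivity
    field_simp
  have hprod : 3 ^ 3 / (c₀ * (((F.cover jc).L : ℝ) ^ (K - n)) ^ 3) * 8 * (c₀ * ((F.L : ℝ) ^ 3) ^ (K - n)) = 216 := by
    rw [hLc, ← pow_mul, ← pow_mul, mul_comm (K - n) 3]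
    have h3' : (F.L : ℝ) ^ (3 * (K - n)) ≠ 0 := by positivity
    field_simp
    ring
  have hCr : Real.sqrt (3 ^ 3 / (c₀ * (((F.cover jc).L : ℝ) ^ (K - n)) ^ 3) * 8) * Real.sqrt (c₀ * ((F.L : ℝ) ^ 3) ^ (K - n)) = Real.sqrt 216 := by
    rw [← Real.sqrt_mul (by rw [hLc]; positivity), hprod]
  rw [hM, hX]
  refine Eq.trans (b := (Real.sqrt (3 ^ 3 / (c₀ * (((F.cover jc).L : ℝ) ^ (K - n)) ^ 3) * 8) * Real.sqrt (c₀ * ((F.L : ℝ) ^ 3) ^ (K - n)))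
      * (Real.sqrt (8 * Real.exp (3 * min μ (1 / 4)) * Real.exp (6 * μ) * (2 * (1 + 1 / μ)) ^ 3) * (8 * Real.sqrt (max 2 (16 / am)) ^ 2))) (by ring) ?_
  rw [hCr]

end Pin

/-! ## §2 ★★★ hPcol at EVERY member — room or no room -/

section Member

variable (F : T3Family) {n K : ℕ} (h : n ≤ K) {c₀ cB : ℝ} [Fact (0 < c₀)] [Fact (0 < cB)]
  {ε₀ : ℝ} (hε₀ : 0 < ε₀) (U₀ : GaugeField (F.P K) 0 (Matrix.specialUnitaryGroup (Fin 2) ℂ)) (hreg : RegPr F n K ε₀ U₀)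

include hε₀ hreg in
-- HEARTBEAT rule (README): the 4-kchar closed statement + the cover branch (two LOD-data packages, two §6 instantiations, PIN-A) — decl-local insurance as PIN-B ∕ ✓p765417, never file-global.
set_option maxHeartbeats 400000 in
/-- ★★★ **hPcol AT EVERY MEMBER, FAMILIES OF RECORD DISCHARGED — ROOM OR NO ROOM.**  With the no-wrap room PIN-B ✓`hPcol_member_of_lift` applies; without it, the member's `Q″ ι T G` of
record and V5b's `hcol` stay at the member, while `hGsup`∕`hT1` come down from the `L³`-fold cover `F.cover 3` (which HAS room, ✓`room_cover`) through px12 g16's ✓`hGsup_of_cover`∕`hT1_of_cover`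
(`G_a` is natural under the cover; constants UNCHANGED), the cover member's ✓p765745 §6 constants being the member's numbers by §1.  SAME conclusion as PIN-B: `… ≤ p139⋆(am, ε₀)·‖E‖`.
[cite: Balaban1985Variational, (138)–(139) p.299, (144) p.300; Balaban1985BackgroundPropagators, Thm 3.1–3.3 pp.397–399; Balaban1987RG1, (0.1)–(0.2) pp.251–252] -/
theorem hPcol_member_all (hnK : n < K) (hε12 : 10 ^ 12 * (F.L : ℝ) ^ 3 * ε₀ ≤ 1) {am : ℝ} (ham : 0 < am)
    (hLift : ∀ cf : Site (F.P K) (K - n) → Matrix (Fin 2) (Fin 2) ℂ,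
      (∀ e : PBond (F.P K) (K - n), cf e.src = ((emlIterU (K - n) (bgUnits F K U₀) e : (Matrix (Fin 2) (Fin 2) ℂ)ˣ) : Matrix (Fin 2) (Fin 2) ℂ) * cf e.tgt *
        (((emlIterU (K - n) (bgUnits F K U₀) e)⁻¹ : (Matrix (Fin 2) (Fin 2) ℂ)ˣ) : Matrix (Fin 2) (Fin 2) ℂ)) →
      ∃ l₀ : Site (F.P K) 0 → Matrix (Fin 2) (Fin 2) ℂ,
        (∀ b : PBond (F.P K) 0, l₀ b.src = ((bgUnits F K U₀ b : (Matrix (Fin 2) (Fin 2) ℂ)ˣ) : Matrix (Fin 2) (Fin 2) ℂ) * l₀ b.tgt * (((bgUnits F K U₀ b)⁻¹ : (Matrix (Fin 2) (Fin 2) ℂ)ˣ) : Matrix (Fin 2) (Fin 2) ℂ)) ∧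
        ∀ y : Site (F.P K) (K - n), l₀ (embIter (K - n) y) = cf y)
    {a' : ℝ} (ha' : 0 ≤ a')
    (hsmall : exists_curved_localGradient.choose * ((48 * ε₀) * (6 * Real.sqrt 2 * Real.sqrt 10 + 6 * Real.sqrt 2)) ≤ 1 / 2)
    (bd : PBond (F.P K) 0) (E : Matrix (Fin 2) (Fin 2) ℂ) :
    ∑ x : Site (F.P K) 0, ‖(toL2S F K c₀).symm (GprimeP F n K h c₀ cB a' U₀ (RS F n K h c₀ cB U₀ (DstarL2 F n K c₀ U₀ (toL2 F K c₀ (Pi.single bd E))))) x‖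
      ≤ 4 * Real.sqrt 2 * ((2 * (exists_curved_localGradient.choose * ((((14 * (8 * Real.exp (3 * min (1 / (10 * Real.sqrt (max 2 (16 / am)) * Real.sqrt (27 + 2025 / 8 * am))) (1 / 4)) * (1 + Real.exp (3 * (1 / (10 * Real.sqrt (max 2 (16 / am)) * Real.sqrt (27 + 2025 / 8 * am)))) * ((am * ((5 / 4) * Real.sqrt 2) * Real.sqrt (25 / 8) * (8 * Real.sqrt (max 2 (16 / am)) ^ 2)))))) + ((Real.sqrt 216 * (Real.sqrt (8 * Real.exp (3 * min (1 / (10 * Real.sqrt (max 2 (16 / am)) * Real.sqrt (27 + 2025 / 8 * am))) (1 / 4)) * Real.exp (6 * (1 / (10 * Real.sqrt (max 2 (16 / am)) * Real.sqrt (27 + 2025 / 8 * am)))) * (2 * (1 + 1 / (1 / (10 * Real.sqrt (max 2 (16 / am)) * Real.sqrt (27 + 2025 / 8 * am))))) ^ 3) * (8 * Real.sqrt (max 2 (16 / am)) ^ 2))))) * (2 * (1 + 1 / (min (1 / (10 * Real.sqrt (max 2 (16 / am)) * Real.sqrt (27 + 2025 / 8 * am))) (1 / 4) / 2))) ^ 3)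 * (2 + 2 * Real.sqrt 2 * (4 * ε₀ * (3 + 2457 * norm_bgOfCfg_axialT_sub_le.choose)) + (24 * Real.sqrt 10 + 48) * (48 * ε₀) ^ 2) + (((am * ((5 / 4) * Real.sqrt 2) * Real.sqrt (25 / 8) * (Real.exp (3 * (1 / (10 * Real.sqrt (max 2 (16 / am)) * Real.sqrt (27 + 2025 / 8 * am)))) * (8 * Real.sqrt (max 2 (16 / am)) ^ 2))) * (2 * (1 + 1 / (1 / (10 * Real.sqrt (max 2 (16 / am)) * Real.sqrt (27 + 2025 / 8 * am))))) ^ 3) + 1)) + 2 * Real.sqrt 2 * (48 * ε₀) * (((14 * (8 * Real.exp (3 * min (1 / (10 * Real.sqrt (max 2 (16 / am)) * Real.sqrt (27 + 2025 / 8 * am))) (1 / 4)) * (1 + Real.exp (3 * (1 / (10 * Real.sqrt (max 2 (16 / am)) * Real.sqrt (27 + 2025 / 8 * am)))) * ((am * ((5 / 4) * Real.sqrt 2) * Real.sqrt (25 / 8) * (8 * Real.sqrt (max 2 (16 / am)) ^ 2)))))) + ((Real.sqrt 216 * (Real.sqrt (8 * Real.exp (3 * min (1 / (10 * Real.sqrt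 (max 2 (16 / am)) * Real.sqrt (27 + 2025 / 8 * am))) (1 / 4)) * Real.exp (6 * (1 / (10 * Real.sqrt (max 2 (16 / am)) * Real.sqrt (27 + 2025 / 8 * am)))) * (2 * (1 + 1 / (1 / (10 * Real.sqrt (max 2 (16 / am)) * Real.sqrt (27 + 2025 / 8 * am))))) ^ 3) * (8 * Real.sqrt (max 2 (16 / am)) ^ 2))))) * (2 * (1 + 1 / (min (1 / (10 * Real.sqrt (max 2 (16 / am)) * Real.sqrt (27 + 2025 / 8 * am))) (1 / 4) / 2))) ^ 3))) * (5 * (1 + (10 * (18 / (2 / ((1 + 25 / 8) * (600 * (27 / 4 : ℝ) ^ 6 + am))) ^ 2) * (4 * (2 * (1 + 1 / (min ((1 / (10 * Real.sqrt (max 2 (16 / am)) * Real.sqrt (27 + 2025 / 8 * am))) / 2) ((2 / ((1 + 25 / 8) * (600 * (27 / 4 : ℝ) ^ 6 + am))) / (3 * (Real.sqrt (max 2 (16 / am)) * (2 + Real.sqrt (max 2 (16 / am))) * (3 * Real.sqrt 3 + 27 + 9 * Real.sqrt am * Real.sqrt (25 / 8) + 81 * am * (25 / 8)) * (8 * Real.sqrt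 (max 2 (16 / am)) + 8 * Real.sqrt (max 2 (16 / am)) ^ 2) * (10 * Real.sqrt (25 / 8)) + 9 * (max 2 (16 / am)) * Real.sqrt (25 / 8))))))) ^ 3) * (((14 * (8 * Real.exp (3 * min (1 / (10 * Real.sqrt (max 2 (16 / am)) * Real.sqrt (27 + 2025 / 8 * am))) (1 / 4)) * (((5 / 2 : ℝ)) + Real.exp (3 * (1 / (10 * Real.sqrt (max 2 (16 / am)) * Real.sqrt (27 + 2025 / 8 * am)))) * ((am * (5 / 2) * (25 / 8) * (8 * max 2 (16 / am))))))) + ((Real.sqrt 432 * (Real.sqrt (8 * Real.exp (3 * min (1 / (10 * Real.sqrt (max 2 (16 / am)) * Real.sqrt (27 + 2025 / 8 * am))) (1 / 4)) * Real.exp (6 * (1 / (10 * Real.sqrt (max 2 (16 / am)) * Real.sqrt (27 + 2025 / 8 * am)))) * (2 * (1 + 1 / (1 / (10 * Real.sqrt (max 2 (16 / am)) * Real.sqrt (27 + 2025 / 8 * am))))) ^ 3) * ((8 * max 2 (16 / am)) * Real.sqrt (25 / 8)))))) * (2 * (1 + 1 / (min (1 / (10 * Real.sqrt (max 2 (16 /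 am)) * Real.sqrt (27 + 2025 / 8 * am))) (1 / 4) / 2))) ^ 3)) * (((14 * (8 * Real.exp (3 * min (1 / (10 * Real.sqrt (max 2 (16 / am)) * Real.sqrt (27 + 2025 / 8 * am))) (1 / 4)) * (1 + Real.exp (3 * (1 / (10 * Real.sqrt (max 2 (16 / am)) * Real.sqrt (27 + 2025 / 8 * am)))) * ((am * ((5 / 4) * Real.sqrt 2) * Real.sqrt (25 / 8) * (8 * Real.sqrt (max 2 (16 / am)) ^ 2)))))) + ((Real.sqrt 216 * (Real.sqrt (8 * Real.exp (3 * min (1 / (10 * Real.sqrt (max 2 (16 / am)) * Real.sqrt (27 + 2025 / 8 * am))) (1 / 4)) * Real.exp (6 * (1 / (10 * Real.sqrt (max 2 (16 / am)) * Real.sqrt (27 + 2025 / 8 * am)))) * (2 * (1 + 1 / (1 / (10 * Real.sqrt (max 2 (16 / am)) * Real.sqrt (27 + 2025 / 8 * am))))) ^ 3) * (8 * Real.sqrt (max 2 (16 / am)) ^ 2))))) * (2 * (1 + 1 / (min (1 / (10 * Real.sqrt (max 2 (16 / am)) * Real.sqrt (27 + 2025 / 8 * am))) (1 / 4) / 2)))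 ^ 3)))) * ‖E‖ := by
  by_cases hroom : 2 * (12 * F.L ^ (K - n) + 5) ≤ (F.P K).sitesPerDir 0
  · exact hPcol_member_of_lift F h hε₀ U₀ hreg hnK hε12 ham hLift ha' hroom hsmall bd E
  -- no room: read `hGsup`∕`hT1` on the cover `F.cover 3`
  have hc₀ : 0 < c₀ := Fact.out
  have hL1 : (1 : ℝ) < F.L := by exact_mod_cast F.hL.2
  have hL0 : (0 : ℝ) < F.L := by linarith
  have hLP := (F.P K).L_pos
  have hε7 : 10 ^ 7 * (F.L : ℝ) ^ 3 * ε₀ ≤ 1 := by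
    have h1 : (10 : ℝ) ^ 7 * (F.L : ℝ) ^ 3 * ε₀ ≤ 10 ^ 12 * (F.L : ℝ) ^ 3 * ε₀ := by
      have : 0 ≤ (F.L : ℝ) ^ 3 * ε₀ := by positivity
      nlinarith
    exact h1.trans hε12
  -- the member's data of record at the pinned weight
  obtain ⟨Q'', D', -, -, htop, hseq, hker⟩ := exists_intertwiner_of_regPr F h (c₀ := c₀) cB hε₀ hε12 U₀ hreg
  have hRS := RS_eq_projR_of_lift F h cB hε₀ hε12 U₀ hreg hLift Q'' htop hker
  haveI hc₁ : Fact (0 < c₀ * ((F.L : ℝ) ^ 3) ^ (K - n)) := ⟨by positivity⟩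
  obtain ⟨ι', hι'⟩ : ∃ ι' : (Site (F.P K) (K - n) → Matrix (Fin 2) (Fin 2) ℂ) →ₗ[ℂ] SiteL2K ℂ 3 (periodsT3 F n) (c₀ * ((F.L : ℝ) ^ 3) ^ (K - n)) W₂,
      ∀ c, ι' c = toL2S F n (c₀ * ((F.L : ℝ) ^ 3) ^ (K - n)) (fun z => c (siteShift (sites_eq F n K h) z)) :=
    ⟨(toL2S F n (c₀ * ((F.L : ℝ) ^ 3) ^ (K - n))).toLinearMap ∘ₗ LinearMap.funLeft ℂ (Matrix (Fin 2) (Fin 2) ℂ) (siteShift (sites_eq F n K h)), fun c => rfl⟩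
  obtain ⟨T', hT'⟩ : ∃ T' : SiteL2K ℂ 3 (periodsT3 F n) (c₀ * ((F.L : ℝ) ^ 3) ^ (K - n)) W₂ →ₗ[ℂ] SiteL2K ℂ 3 (periodsT3 F K) c₀ W₂,
      ∀ (l : SiteL2K ℂ 3 (periodsT3 F K) c₀ W₂) (f : SiteL2K ℂ 3 (periodsT3 F n) (c₀ * ((F.L : ℝ) ^ 3) ^ (K - n)) W₂), ⟪ι' (Q'' l), f⟫_ℂ = ⟪l, T' f⟫_ℂ :=
    ⟨LinearMap.adjoint (ι' ∘ₗ Q''), fun l f => by rw [LinearMap.adjoint_inner_right, LinearMap.comp_apply]⟩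
  obtain ⟨G', hAG', hGA', -⟩ := exists_massive_inverse F h hε₀ hε7 U₀ hreg Q'' hseq ι' hι' T' hT' ham
  -- the member's raw letters and its column window at `μ(am)` (for V5b's `hcol`)
  have hsx : (25 / 8) * (c₀ * ((F.L : ℝ) ^ 3) ^ (K - n) * ((((F.P K).L : ℝ) ^ (F.P K).d) ^ (K - n))⁻¹ / c₀) = 25 / 8 := by
    rw [show ((F.P K).L : ℝ) = (F.L : ℝ) from rfl, T3Family.P_d]; field_simp
  have hMraw : 16 * c₀ * ((F.L : ℝ) ^ (K - n)) ^ 3 / (am * (c₀ * ((F.L : ℝ) ^ 3) ^ (K - n))) = 16 / am := by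
    rw [← pow_mul, ← pow_mul, Nat.mul_comm]; field_simp
  have hM : max 2 (16 * c₀ * ((F.L : ℝ) ^ (K - n)) ^ 3 / (am * (c₀ * ((F.L : ℝ) ^ 3) ^ (K - n)))) = max 2 (16 / am) := by rw [hMraw]
  have hη : 0 < eta F n K := eta_pos F n K
  have hη1 : eta F n K ≤ 1 := by
    show ((F.L : ℝ)⁻¹) ^ (K - n) ≤ 1
    exact pow_le_one₀ (inv_nonneg.2 hL0.le) (inv_le_one_of_one_le₀ hL1.le)
  have hM'2 : (2 : ℝ) ≤ max 2 (16 / am) := le_max_left _ _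
  have hcδ1 : (1 : ℝ) ≤ 27 + 2025 / 8 * am := by linarith [ham.le]
  have hsM1 : 1 ≤ Real.sqrt (max 2 (16 / am)) := Real.one_le_sqrt.2 (by linarith)
  have hsc1 : 1 ≤ Real.sqrt (27 + 2025 / 8 * am) := Real.one_le_sqrt.2 hcδ1
  have hμ0 : 0 < (1 / (10 * Real.sqrt (max 2 (16 / am)) * Real.sqrt (27 + 2025 / 8 * am))) := by positivity
  have hμ10 : 10 * (1 / (10 * Real.sqrt (max 2 (16 / am)) * Real.sqrt (27 + 2025 / 8 * am))) ≤ 1 := by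
    have h1 : (1 : ℝ) ≤ Real.sqrt (max 2 (16 / am)) * Real.sqrt (27 + 2025 / 8 * am) := one_le_mul_of_one_le_of_one_le hsM1 hsc1
    rw [show 10 * (1 / (10 * Real.sqrt (max 2 (16 / am)) * Real.sqrt (27 + 2025 / 8 * am))) = 1 / (Real.sqrt (max 2 (16 / am)) * Real.sqrt (27 + 2025 / 8 * am)) by field_simp]
    rw [div_le_one (by positivity)]
    exact h1
  have hμ3 : 3 * (1 / (10 * Real.sqrt (max 2 (16 / am)) * Real.sqrt (27 + 2025 / 8 * am))) ≤ 1 := by linarith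
  have hδ := window_delta (a := am) (sx := ((25 / 8) * (c₀ * ((F.L : ℝ) ^ 3) ^ (K - n) * ((((F.P K).L : ℝ) ^ (F.P K).d) ^ (K - n))⁻¹ / c₀))) (η := eta F n K) ham hsx hη hη1 hμ0.le hμ3
  have hwin := window_win ham hM
  have hcol := hcol_of_massiveColumn_decay F h hε₀ hε7 U₀ hreg Q'' hseq ι' hι' T' hT' ham G' hAG' hμ0 (δ₂ := (Real.sqrt (27 + 2025 / 8 * am) * (1 / (10 * Real.sqrt (max 2 (16 / am)) * Real.sqrt (27 + 2025 / 8 * am))))) (by positivity) hδ hwin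
  -- the cover member `F.cover 3`: `RegPr`, its data of record at the SAME weight and mass, its window rows, its ROOM
  have hregc : RegPr (F.cover 3) n K ε₀ (U₀ ∘ projBond (F.P K) 3 0) := (regPr_cover_iff 3 F ε₀ U₀).mpr hreg
  have hWc : 10 ^ 12 * ((F.cover 3).L : ℝ) ^ 3 * ε₀ ≤ 1 := by rw [T3Family.cover_L]; exact hε12
  have hε7c : 10 ^ 7 * ((F.cover 3).L : ℝ) ^ 3 * ε₀ ≤ 1 := by rw [T3Family.cover_L]; exact hε7
  obtain ⟨Qc, Dc, -, -, -, hseqc, -⟩ := exists_intertwiner_of_regPr (F.cover 3) h (c₀ := c₀) cB hε₀ hWc (U₀ ∘ projBond (F.P K) 3 0) hregc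
  obtain ⟨ιc, hιc⟩ : ∃ ιc : (Site ((F.cover 3).P K) (K - n) → Matrix (Fin 2) (Fin 2) ℂ) →ₗ[ℂ] SiteL2K ℂ 3 (periodsT3 (F.cover 3) n) (c₀ * ((F.L : ℝ) ^ 3) ^ (K - n)) W₂,
      ∀ c, ιc c = toL2S (F.cover 3) n (c₀ * ((F.L : ℝ) ^ 3) ^ (K - n)) (fun z => c (siteShift (sites_eq (F.cover 3) n K h) z)) :=
    ⟨(toL2S (F.cover 3) n (c₀ * ((F.L : ℝ) ^ 3) ^ (K - n))).toLinearMap ∘ₗ LinearMap.funLeft ℂ (Matrix (Fin 2) (Fin 2) ℂ) (siteShift (sites_eq (F.cover 3) n K h)), fun c => rfl⟩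
  obtain ⟨Tc, hTc⟩ : ∃ Tc : SiteL2K ℂ 3 (periodsT3 (F.cover 3) n) (c₀ * ((F.L : ℝ) ^ 3) ^ (K - n)) W₂ →ₗ[ℂ] SiteL2K ℂ 3 (periodsT3 (F.cover 3) K) c₀ W₂,
      ∀ (l : SiteL2K ℂ 3 (periodsT3 (F.cover 3) K) c₀ W₂) (f : SiteL2K ℂ 3 (periodsT3 (F.cover 3) n) (c₀ * ((F.L : ℝ) ^ 3) ^ (K - n)) W₂), ⟪ιc (Qc l), f⟫_ℂ = ⟪l, Tc f⟫_ℂ :=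
    ⟨LinearMap.adjoint (ιc ∘ₗ Qc), fun l f => by rw [LinearMap.adjoint_inner_right, LinearMap.comp_apply]⟩
  obtain ⟨Gc, hAGc, hGAc, -⟩ := exists_massive_inverse (F.cover 3) h hε₀ hε7c (U₀ ∘ projBond (F.P K) 3 0) hregc Qc hseqc ιc hιc Tc hTc ham
  have hsxc : (25 / 8) * (c₀ * ((F.L : ℝ) ^ 3) ^ (K - n) * ((((((F.cover 3).P K).L : ℝ) ^ ((F.cover 3).P K).d) ^ (K - n)))⁻¹ / c₀) = 25 / 8 := by
    rw [show (((F.cover 3).P K).L : ℝ) = (F.L : ℝ) from rfl, T3Family.P_d]; field_simp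
  have hMc : max 2 (16 * c₀ * (((F.cover 3).L : ℝ) ^ (K - n)) ^ 3 / (am * (c₀ * ((F.L : ℝ) ^ 3) ^ (K - n)))) = max 2 (16 / am) := by
    rw [show ((F.cover 3).L : ℝ) = (F.L : ℝ) from rfl, hMraw]
  have hηc : 0 < eta (F.cover 3) n K := eta_pos (F.cover 3) n K
  have hη1c : eta (F.cover 3) n K ≤ 1 := by
    show (((F.cover 3).L : ℝ)⁻¹) ^ (K - n) ≤ 1
    rw [show ((F.cover 3).L : ℝ) = (F.L : ℝ) from rfl]
    exact pow_le_one₀ (inv_nonneg.2 hL0.le) (inv_le_one_of_one_le₀ hL1.le)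
  have hδc := window_delta (a := am) (sx := ((25 / 8) * (c₀ * ((F.L : ℝ) ^ 3) ^ (K - n) * ((((((F.cover 3).P K).L : ℝ) ^ ((F.cover 3).P K).d) ^ (K - n)))⁻¹ / c₀))) (η := eta (F.cover 3) n K) ham hsxc hηc hη1c hμ0.le hμ3
  have hwinc := window_win ham hMc
  have hroomc := room_cover F 3 h (le_refl 3)
  have hGc := hGsup_of_regPr (F.cover 3) h hε₀ hε7c (U₀ ∘ projBond (F.P K) 3 0) hregc Qc hseqc ιc hιc Tc hTc ham Gc hAGc hμ0 (δ₁ := (Real.sqrt (27 + 2025 / 8 * am) * (1 / (10 * Real.sqrt (max 2 (16 / am)) * Real.sqrt (27 + 2025 / 8 * am))))) (by positivity) hδc hwinc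
  have hTc' := hT1_of_regPr (F.cover 3) h hε₀ hε7c (U₀ ∘ projBond (F.P K) 3 0) hregc Qc hseqc ιc hιc Tc hTc ham Gc hAGc hμ0 (δ₁ := (Real.sqrt (27 + 2025 / 8 * am) * (1 / (10 * Real.sqrt (max 2 (16 / am)) * Real.sqrt (27 + 2025 / 8 * am))))) (by positivity) hδc hwinc hroomc hsmall
  -- the cover member's constants ARE the member's numbers (§1)
  rw [unitP1_cover F 3 hc₀ ham, unitP2_cover F 3 hc₀ ham] at hGc
  rw [unitP1_cover F 3 hc₀ ham, unitP3_cover F 3 hc₀ ham, unitP2_cover F 3 hc₀ ham] at hTc'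
  -- descend the two letters to the member (px12 g16)
  have hGsup := hGsup_of_cover F 3 h c₀ U₀ Q'' hseq ι' hι' T' hT' Qc hseqc ιc hιc Tc hTc am G' hAG' Gc hGAc hGc
  have hT1 := hT1_of_cover F 3 h c₀ U₀ Q'' hseq ι' hι' T' hT' Qc hseqc ιc hιc Tc hTc am G' hAG' Gc hGAc hTc'
  -- PIN-A at the member's letters, then the `C_pt` leaves
  have hκ : 0 < min (1 / (10 * Real.sqrt (max 2 (16 / am)) * Real.sqrt (27 + 2025 / 8 * am))) (1 / 4) / 2 := by positivity
  have hCpt : 0 ≤ (14 * (8 * Real.exp (3 * min (1 / (10 * Real.sqrt (max 2 (16 / am)) * Real.sqrt (27 + 2025 / 8 * am))) (1 / 4)) * ((5 / 4) * Real.sqrt (2 * (c₀ * ((F.L : ℝ) ^ 3) ^ (K - n))) * ((((F.P K).L : ℝ) ^ (F.P K).d) ^ (K - n))⁻¹ / c₀ * Real.sqrt (2 * (c₀ * ((F.L : ℝ) ^ 3) ^ (K - n))) + Real.exp (3 * (1 / (10 * Real.sqrt (max 2 (16 / am)) * Real.sqrt (27 + 2025 / 8 * am)))) * ((am * ((5 /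 4) * Real.sqrt (2 * (c₀ * ((F.L : ℝ) ^ 3) ^ (K - n))) * ((((F.P K).L : ℝ) ^ (F.P K).d) ^ (K - n))⁻¹ / c₀) * Real.sqrt ((25 / 8) * ((c₀ * ((F.L : ℝ) ^ 3) ^ (K - n)) * ((((F.P K).L : ℝ) ^ (F.P K).d) ^ (K - n))⁻¹ / c₀))) * ((8 * Real.sqrt (max 2 (16 * c₀ * ((F.L : ℝ) ^ (K - n)) ^ 3 / (am * (c₀ * ((F.L : ℝ) ^ 3) ^ (K - n))))) ^ 2) * (Real.sqrt ((25 / 8) * ((c₀ * ((F.L : ℝ) ^ 3) ^ (K - n)) * ((((F.P K).L : ℝ) ^ (F.P K).d) ^ (K - n))⁻¹ / c₀)) * Real.sqrt (2 * (c₀ * ((F.L : ℝ) ^ 3) ^ (K - n))))))))) + (Real.sqrt (3 ^ 3 / (c₀ * ((F.L : ℝ) ^ (K - n)) ^ 3) * 8) * (Real.sqrt (8 * Real.exp (3 * min (1 / (10 * Real.sqrt (max 2 (16 / am)) * Real.sqrt (27 + 2025 / 8 * am))) (1 / 4)) * Real.exp (6 * (1 / (10 * Real.sqrt (max 2 (16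 / am)) * Real.sqrt (27 + 2025 / 8 * am)))) * (2 * (1 + 1 / (1 / (10 * Real.sqrt (max 2 (16 / am)) * Real.sqrt (27 + 2025 / 8 * am))))) ^ 3) * ((8 * Real.sqrt (max 2 (16 * c₀ * ((F.L : ℝ) ^ (K - n)) ^ 3 / (am * (c₀ * ((F.L : ℝ) ^ 3) ^ (K - n))))) ^ 2) * (Real.sqrt ((25 / 8) * ((c₀ * ((F.L : ℝ) ^ 3) ^ (K - n)) * ((((F.P K).L : ℝ) ^ (F.P K).d) ^ (K - n))⁻¹ / c₀)) * Real.sqrt (2 * (c₀ * ((F.L : ℝ) ^ 3) ^ (K - n))))))) := by positivity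
  have hfin := hPcol_pin F h hε₀ hε7 U₀ hreg Q'' hseq hRS hker hnK ham ι' hι' T' hT' G' hAG' hGA' ha' hκ hCpt hcol hGsup hT1 bd E
  rw [unitU3_pin F hc₀ ham, unitU1_pin F hc₀ ham, unitA_pin F hc₀] at hfin
  exact hfin

end Member

/-! ## §3 ★★★ The socket: `αP`, `pP` ∃-packaged -/

-- HEARTBEAT rule (README): the 4-kchar closed witness `pP` + the socket binder in one declaration — decl-local insurance as ✓p765417 (`whnf`-class), never file-global.
set_option maxHeartbeats 400000 in
/-- ★★★ **THE hPcol ROW FOR EVERY MEMBER OF EVERY FAMILY — `αP`, `pP` ∃-PACKAGED (namer w2 g12's S47 socket, `G′ᴾ`'s parameter the FREE `0 ≤ a′`).**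
`αP L := min (10⁻¹²L⁻³) (1∕(2·(C_g+1)·48(6√2√10+6√2)))`, `pP L := p139⋆(1, αP L)` (§2 at `am := 1`).
[cite: Balaban1985Variational, (138)–(139) p.299; Balaban1985BackgroundPropagators, Thm 3.1 (3.42) p.397, (3.49) p.399, (3.114)–(3.122) pp.418–420] -/
theorem hPcol_allMembers_exists (c₀ cB : ℕ → ℝ) [hc₀ : ∀ L : ℕ, Fact (0 < c₀ L)] [hcB : ∀ L : ℕ, Fact (0 < cB L)] :
    ∃ (αP pP : ℕ → ℝ), (∀ L : ℕ, 1 < L → 0 < αP L) ∧ (∀ L : ℕ, 1 < L → 0 ≤ pP L) ∧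
      ∀ (L : ℕ), 1 < L → ∀ (i : T3Thm1Carrier.Idx L) (a' : ℝ), 0 ≤ a' → ∀ (U₀ : GaugeField (i.1.1.P i.1.2.2) 0 (Matrix.specialUnitaryGroup (Fin 2) ℂ)), RegPr i.1.1 i.1.2.1 i.1.2.2 (αP L) U₀ →
      (∀ cf : Site (i.1.1.P i.1.2.2) (i.1.2.2 - i.1.2.1) → Matrix (Fin 2) (Fin 2) ℂ,
      (∀ e' : PBond (i.1.1.P i.1.2.2) (i.1.2.2 - i.1.2.1), cf e'.src = ((emlIterU (i.1.2.2 - i.1.2.1) (bgUnits i.1.1 i.1.2.2 U₀) e' : (Matrix (Fin 2) (Fin 2) ℂ)ˣ) : Matrix (Fin 2) (Fin 2) ℂ) * cf e'.tgt *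
      (((emlIterU (i.1.2.2 - i.1.2.1) (bgUnits i.1.1 i.1.2.2 U₀) e')⁻¹ : (Matrix (Fin 2) (Fin 2) ℂ)ˣ) : Matrix (Fin 2) (Fin 2) ℂ)) →
      ∃ l₀ : Site (i.1.1.P i.1.2.2) 0 → Matrix (Fin 2) (Fin 2) ℂ,
      (∀ b' : PBond (i.1.1.P i.1.2.2) 0, l₀ b'.src = ((bgUnits i.1.1 i.1.2.2 U₀ b' : (Matrix (Fin 2) (Fin 2) ℂ)ˣ) : Matrix (Fin 2) (Fin 2) ℂ) * l₀ b'.tgt * (((bgUnits i.1.1 i.1.2.2 U₀ b')⁻¹ : (Matrix (Fin 2) (Fin 2) ℂ)ˣ) : Matrix (Fin 2) (Fin 2) ℂ)) ∧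
      ∀ y : Site (i.1.1.P i.1.2.2) (i.1.2.2 - i.1.2.1), l₀ (embIter (i.1.2.2 - i.1.2.1) y) = cf y) →
      ∀ (bd : PBond (i.1.1.P i.1.2.2) 0) (E : Matrix (Fin 2) (Fin 2) ℂ),
      ∑ x : Site (i.1.1.P i.1.2.2) 0, ‖(toL2S i.1.1 i.1.2.2 (c₀ L)).symm (GprimeP i.1.1 i.1.2.1 i.1.2.2 i.2.2.le (c₀ L) (cB L) a' U₀
      (RS i.1.1 i.1.2.1 i.1.2.2 i.2.2.le (c₀ L) (cB L) U₀ (DstarL2 i.1.1 i.1.2.1 i.1.2.2 (c₀ L) U₀ (toL2 i.1.1 i.1.2.2 (c₀ L) (Pi.single bd E))))) x‖ ≤ pP L * ‖E‖ := by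
  have hCg0 : 0 ≤ exists_curved_localGradient.choose := exists_curved_localGradient.choose_spec.1
  obtain ⟨hC0, -⟩ := norm_bgOfCfg_axialT_sub_le.choose_spec
  have hS : (0:ℝ) < 48 * (6 * Real.sqrt 2 * Real.sqrt 10 + 6 * Real.sqrt 2) := by positivity
  refine ⟨fun L => (min (1 / (10 ^ 12 * (L : ℝ) ^ 3)) (1 / (2 * ((exists_curved_localGradient.choose + 1) * (48 * (6 * Real.sqrt 2 * Real.sqrt 10 + 6 * Real.sqrt 2)))))),
    fun L => 4 * Real.sqrt 2 * ((2 * (exists_curved_localGradient.choose * ((((14 * (8 * Real.exp (3 * min (1 / (10 * Real.sqrt (max 2 (16 / (1:ℝ))) * Real.sqrt (27 + 2025 / 8 * (1:ℝ)))) (1 / 4)) * (1 + Real.exp (3 * (1 / (10 * Real.sqrt (max 2 (16 / (1:ℝ))) * Real.sqrt (27 + 2025 / 8 * (1:ℝ))))) * (((1:ℝ) * ((5 / 4) * Real.sqrt 2) * Real.sqrt (25 / 8) * (8 * Real.sqrt (max 2 (16 / (1:ℝ))) ^ 2)))))) + ((Real.sqrt 216 * (Real.sqrt (8 * Real.exp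 (3 * min (1 / (10 * Real.sqrt (max 2 (16 / (1:ℝ))) * Real.sqrt (27 + 2025 / 8 * (1:ℝ)))) (1 / 4)) * Real.exp (6 * (1 / (10 * Real.sqrt (max 2 (16 / (1:ℝ))) * Real.sqrt (27 + 2025 / 8 * (1:ℝ))))) * (2 * (1 + 1 / (1 / (10 * Real.sqrt (max 2 (16 / (1:ℝ))) * Real.sqrt (27 + 2025 / 8 * (1:ℝ)))))) ^ 3) * (8 * Real.sqrt (max 2 (16 / (1:ℝ))) ^ 2))))) * (2 * (1 + 1 / (min (1 / (10 * Real.sqrt (max 2 (16 / (1:ℝ))) * Real.sqrt (27 + 2025 / 8 * (1:ℝ)))) (1 / 4) / 2))) ^ 3) * (2 + 2 * Real.sqrt 2 * (4 * (min (1 / (10 ^ 12 * (L : ℝ) ^ 3)) (1 / (2 * ((exists_curved_localGradient.choose + 1) * (48 * (6 * Real.sqrt 2 * Real.sqrt 10 + 6 * Real.sqrt 2)))))) * (3 + 2457 * norm_bgOfCfg_axialT_sub_le.choose)) + (24 * Real.sqrt 10 + 48) * (48 * (min (1 / (10 ^ 12 * (L : ℝ) ^ 3)) (1 / (2 * ((exists_curved_localGradient.choose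 + 1) * (48 * (6 * Real.sqrt 2 * Real.sqrt 10 + 6 * Real.sqrt 2))))))) ^ 2) + ((((1:ℝ) * ((5 / 4) * Real.sqrt 2) * Real.sqrt (25 / 8) * (Real.exp (3 * (1 / (10 * Real.sqrt (max 2 (16 / (1:ℝ))) * Real.sqrt (27 + 2025 / 8 * (1:ℝ))))) * (8 * Real.sqrt (max 2 (16 / (1:ℝ))) ^ 2))) * (2 * (1 + 1 / (1 / (10 * Real.sqrt (max 2 (16 / (1:ℝ))) * Real.sqrt (27 + 2025 / 8 * (1:ℝ)))))) ^ 3) + 1)) + 2 * Real.sqrt 2 * (48 * (min (1 / (10 ^ 12 * (L : ℝ) ^ 3)) (1 / (2 * ((exists_curved_localGradient.choose + 1) * (48 * (6 * Real.sqrt 2 * Real.sqrt 10 + 6 * Real.sqrt 2))))))) * (((14 * (8 * Real.exp (3 * min (1 / (10 * Real.sqrt (max 2 (16 / (1:ℝ))) * Real.sqrt (27 + 2025 / 8 * (1:ℝ)))) (1 / 4)) * (1 + Real.exp (3 * (1 / (10 * Real.sqrt (max 2 (16 / (1:ℝ))) * Real.sqrt (27 + 2025 / 8 * (1:ℝ)))))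 * (((1:ℝ) * ((5 / 4) * Real.sqrt 2) * Real.sqrt (25 / 8) * (8 * Real.sqrt (max 2 (16 / (1:ℝ))) ^ 2)))))) + ((Real.sqrt 216 * (Real.sqrt (8 * Real.exp (3 * min (1 / (10 * Real.sqrt (max 2 (16 / (1:ℝ))) * Real.sqrt (27 + 2025 / 8 * (1:ℝ)))) (1 / 4)) * Real.exp (6 * (1 / (10 * Real.sqrt (max 2 (16 / (1:ℝ))) * Real.sqrt (27 + 2025 / 8 * (1:ℝ))))) * (2 * (1 + 1 / (1 / (10 * Real.sqrt (max 2 (16 / (1:ℝ))) * Real.sqrt (27 + 2025 / 8 * (1:ℝ)))))) ^ 3) * (8 * Real.sqrt (max 2 (16 / (1:ℝ))) ^ 2))))) * (2 * (1 + 1 / (min (1 / (10 * Real.sqrt (max 2 (16 / (1:ℝ))) * Real.sqrt (27 + 2025 / 8 * (1:ℝ)))) (1 / 4) / 2))) ^ 3))) * (5 * (1 + (10 * (18 / (2 / ((1 + 25 / 8) * (600 * (27 / 4 : ℝ) ^ 6 + (1:ℝ)))) ^ 2) * (4 * (2 * (1 + 1 / (min ((1 / (10 * Real.sqrt (max 2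 (16 / (1:ℝ))) * Real.sqrt (27 + 2025 / 8 * (1:ℝ)))) / 2) ((2 / ((1 + 25 / 8) * (600 * (27 / 4 : ℝ) ^ 6 + (1:ℝ)))) / (3 * (Real.sqrt (max 2 (16 / (1:ℝ))) * (2 + Real.sqrt (max 2 (16 / (1:ℝ)))) * (3 * Real.sqrt 3 + 27 + 9 * Real.sqrt (1:ℝ) * Real.sqrt (25 / 8) + 81 * (1:ℝ) * (25 / 8)) * (8 * Real.sqrt (max 2 (16 / (1:ℝ))) + 8 * Real.sqrt (max 2 (16 / (1:ℝ))) ^ 2) * (10 * Real.sqrt (25 / 8)) + 9 * (max 2 (16 / (1:ℝ))) * Real.sqrt (25 / 8))))))) ^ 3) * (((14 * (8 * Real.exp (3 * min (1 / (10 * Real.sqrt (max 2 (16 / (1:ℝ))) * Real.sqrt (27 + 2025 / 8 * (1:ℝ)))) (1 / 4)) * (((5 / 2 : ℝ)) + Real.exp (3 * (1 / (10 * Real.sqrt (max 2 (16 / (1:ℝ))) * Real.sqrt (27 + 2025 / 8 * (1:ℝ))))) * (((1:ℝ) * (5 / 2) * (25 / 8) * (8 * max 2 (16 / (1:ℝ))))))))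 + ((Real.sqrt 432 * (Real.sqrt (8 * Real.exp (3 * min (1 / (10 * Real.sqrt (max 2 (16 / (1:ℝ))) * Real.sqrt (27 + 2025 / 8 * (1:ℝ)))) (1 / 4)) * Real.exp (6 * (1 / (10 * Real.sqrt (max 2 (16 / (1:ℝ))) * Real.sqrt (27 + 2025 / 8 * (1:ℝ))))) * (2 * (1 + 1 / (1 / (10 * Real.sqrt (max 2 (16 / (1:ℝ))) * Real.sqrt (27 + 2025 / 8 * (1:ℝ)))))) ^ 3) * ((8 * max 2 (16 / (1:ℝ))) * Real.sqrt (25 / 8)))))) * (2 * (1 + 1 / (min (1 / (10 * Real.sqrt (max 2 (16 / (1:ℝ))) * Real.sqrt (27 + 2025 / 8 * (1:ℝ)))) (1 / 4) / 2))) ^ 3)) * (((14 * (8 * Real.exp (3 * min (1 / (10 * Real.sqrt (max 2 (16 / (1:ℝ))) * Real.sqrt (27 + 2025 / 8 * (1:ℝ)))) (1 / 4)) * (1 + Real.exp (3 * (1 / (10 * Real.sqrt (max 2 (16 / (1:ℝ))) * Real.sqrt (27 + 2025 / 8 * (1:ℝ))))) * (((1:ℝ) * ((5 / 4) * Real.sqrt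 2) * Real.sqrt (25 / 8) * (8 * Real.sqrt (max 2 (16 / (1:ℝ))) ^ 2)))))) + ((Real.sqrt 216 * (Real.sqrt (8 * Real.exp (3 * min (1 / (10 * Real.sqrt (max 2 (16 / (1:ℝ))) * Real.sqrt (27 + 2025 / 8 * (1:ℝ)))) (1 / 4)) * Real.exp (6 * (1 / (10 * Real.sqrt (max 2 (16 / (1:ℝ))) * Real.sqrt (27 + 2025 / 8 * (1:ℝ))))) * (2 * (1 + 1 / (1 / (10 * Real.sqrt (max 2 (16 / (1:ℝ))) * Real.sqrt (27 + 2025 / 8 * (1:ℝ)))))) ^ 3) * (8 * Real.sqrt (max 2 (16 / (1:ℝ))) ^ 2))))) * (2 * (1 + 1 / (min (1 / (10 * Real.sqrt (max 2 (16 / (1:ℝ))) * Real.sqrt (27 + 2025 / 8 * (1:ℝ)))) (1 / 4) / 2))) ^ 3)))), ?_, ?_, ?_⟩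
  · -- (E1) `0 < αP L`
    intro L hL
    have hL0 : (0:ℝ) < L := by exact_mod_cast (by omega : 0 < L)
    exact lt_min (by positivity) (by positivity)
  · -- (E2) `0 ≤ pP L`
    intro L hL
    have hL0 : (0:ℝ) < L := by exact_mod_cast (by omega : 0 < L)
    have hα : 0 ≤ (min (1 / (10 ^ 12 * (L : ℝ) ^ 3)) (1 / (2 * ((exists_curved_localGradient.choose + 1) * (48 * (6 * Real.sqrt 2 * Real.sqrt 10 + 6 * Real.sqrt 2)))))) := le_min (by positivity) (by positivity)
    have hM2 : (2:ℝ) ≤ max 2 (16 / (1:ℝ)) := le_max_left _ _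
    have hsM : 0 < Real.sqrt (max 2 (16 / (1:ℝ))) := Real.sqrt_pos.2 (by linarith)
    positivity
  · -- (E3) the row, member by member: §2 at `am := 1`, `ε₀ := αP L`
    intro L hL i a' ha' U₀ hreg hLift bd E
    obtain ⟨⟨F, n, K⟩, hFL, hnK⟩ := i
    subst hFL
    have hL0 : (0:ℝ) < (F.L : ℝ) := by have := F.hL.2; exact_mod_cast (by omega : 0 < F.L)
    have hα0 : 0 < (min (1 / (10 ^ 12 * (F.L : ℝ) ^ 3)) (1 / (2 * ((exists_curved_localGradient.choose + 1) * (48 * (6 * Real.sqrt 2 * Real.sqrt 10 + 6 * Real.sqrt 2)))))) := lt_min (by positivity) (by positivity)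
    have hα12 : 10 ^ 12 * (F.L : ℝ) ^ 3 * (min (1 / (10 ^ 12 * (F.L : ℝ) ^ 3)) (1 / (2 * ((exists_curved_localGradient.choose + 1) * (48 * (6 * Real.sqrt 2 * Real.sqrt 10 + 6 * Real.sqrt 2)))))) ≤ 1 := by
      have hpos : (0:ℝ) < 10 ^ 12 * (F.L : ℝ) ^ 3 := by positivity
      calc 10 ^ 12 * (F.L : ℝ) ^ 3 * (min (1 / (10 ^ 12 * (F.L : ℝ) ^ 3)) (1 / (2 * ((exists_curved_localGradient.choose + 1) * (48 * (6 * Real.sqrt 2 * Real.sqrt 10 + 6 * Real.sqrt 2))))))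
          ≤ 10 ^ 12 * (F.L : ℝ) ^ 3 * (1 / (10 ^ 12 * (F.L : ℝ) ^ 3)) := mul_le_mul_of_nonneg_left (min_le_left _ _) hpos.le
        _ = 1 := by field_simp
    have hsmall : exists_curved_localGradient.choose * ((48 * (min (1 / (10 ^ 12 * (F.L : ℝ) ^ 3)) (1 / (2 * ((exists_curved_localGradient.choose + 1) * (48 * (6 * Real.sqrt 2 * Real.sqrt 10 + 6 * Real.sqrt 2))))))) * (6 * Real.sqrt 2 * Real.sqrt 10 + 6 * Real.sqrt 2)) ≤ 1 / 2 := by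
      have hT0 : (0:ℝ) < (6 * Real.sqrt 2 * Real.sqrt 10 + 6 * Real.sqrt 2) := by positivity
      have hP0 : (0:ℝ) < 10 ^ 12 * (F.L : ℝ) ^ 3 := by positivity
      generalize hT : ((6 * Real.sqrt 2 * Real.sqrt 10 + 6 * Real.sqrt 2) : ℝ) = T at hT0 ⊢
      generalize hC : exists_curved_localGradient.choose = C at hCg0 ⊢
      generalize hP : (10 : ℝ) ^ 12 * (F.L : ℝ) ^ 3 = P at hP0 ⊢
      have hle : min (1 / P) (1 / (2 * ((C + 1) * (48 * T)))) ≤ 1 / (2 * ((C + 1) * (48 * T))) := min_le_right _ _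
      calc C * ((48 * min (1 / P) (1 / (2 * ((C + 1) * (48 * T))))) * T)
          = (C * (48 * T)) * min (1 / P) (1 / (2 * ((C + 1) * (48 * T)))) := by ring
        _ ≤ (C * (48 * T)) * (1 / (2 * ((C + 1) * (48 * T)))) := mul_le_mul_of_nonneg_left hle (by positivity)
        _ = C / (2 * (C + 1)) := by field_simp
        _ ≤ 1 / 2 := by rw [div_le_div_iff₀ (by positivity) (by norm_num)]; nlinarith
    exact hPcol_member_all F hnK.le hα0 U₀ hreg hnK hα12 one_pos hLift ha' hsmall bd E

end Summit.QuantumFields.YangMills.Theorems.Prop7PcolAllMembers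

end
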